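import Summits.CriticalPhenomena.PercolationContinuityZ3.Theorems.PercNearOneGluingNoHeavyPcintBSMZ6Cert
import HarnessLib

/-!
# PCINT lane, PHASE 5 (block-renewal second moment): kernel check 2/2 of the certificate inequalities for `ℤ^6`

Cell `prim-pcint`, seat `prim-pcint-1` (gen 14); memo `run/shared/lean/prim/pcint/T-FIBRE-ROUTE.md` §PHASE 5.
Instance `d = 6 = 3 + 3` (`k = 3` time axes, `t = 3` transverse axes), `β = 7/50` (`s = 4β = 14/25`),
horizon `N = 150`, cell `p = 1518/10^4`. `certLHSz y ≤ φ y · (P^4 k DW² DG)`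
at orbit representatives `y` of `[-2,2]^3` (integer arithmetic; shared-key counts by `BSM.S3`).
-/

namespace Summit.CriticalPhenomena.PercolationContinuityZ3.Theorems.Pcint.BSM.Z6

open Summit.CriticalPhenomena.PercolationContinuityZ3.Theorems.Pcint.BSM

set_option maxHeartbeats 0 in
set_option maxRecDepth 65536 in
/-- The certificate inequalities on the offsets `((reps3.drop 5).take 1)`. -/
theorem hrep_6 : CertOn ((reps3.drop 5).take 1) := by
  unfold CertOn; decide +kernel

set_option maxHeartbeats 0 in
set_option maxRecDepth 65536 in
/-- The certificate inequalities on the offsets `((reps3.drop 6).take 1)`. -/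
theorem hrep_7 : CertOn ((reps3.drop 6).take 1) := by
  unfold CertOn; decide +kernel

set_option maxHeartbeats 0 in
set_option maxRecDepth 65536 in
/-- The certificate inequalities on the offsets `((reps3.drop 7).take 1)`. -/
theorem hrep_8 : CertOn ((reps3.drop 7).take 1) := by
  unfold CertOn; decide +kernel

set_option maxHeartbeats 0 in
set_option maxRecDepth 65536 in
/-- The certificate inequalities on the offsets `((reps3.drop 8).take 1)`. -/
theorem hrep_9 : CertOn ((reps3.drop 8).take 1) := by
  unfold CertOn; decide +kernel

set_option maxHeartbeats 0 in
set_option maxRecDepth 65536 in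
/-- The certificate inequalities on the offsets `(reps3.drop 9)`. -/
theorem hrep_10 : CertOn (reps3.drop 9) := by
  unfold CertOn; decide +kernel

end Summit.CriticalPhenomena.PercolationContinuityZ3.Theorems.Pcint.BSM.Z6
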